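import Summits.BirchSwinnertonDyer.BirchSwinnertonDyer.Theorems.KatoDescentKMCImpReading
import Summits.BirchSwinnertonDyer.BirchSwinnertonDyer.Theorems.RamifiedSevenEllipticUnitsValueOfKMCPerrinRiou
import HarnessLib

set_option linter.dupNamespace false
set_option autoImplicit false

/-!
# Route `RamifiedSevenEllipticUnits` (rung K7r), Value crux `EllipticUnitValueSevenOfGZK`
# (stmt-BirchSwinnertonDyer-19945): the Kato–Perrin-Riou composition over the `→`-ONLY interface reading,
# and — at the CLOSED triple `(IsKatoZetaDescentDatumOf, Kato2004.PRRatio, KatoMainConjectureFine)` — the crux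
# BY NAME from FIVE stub-shaped hypotheses, the interface lemma DISCHARGED in the kernel
# (cell `bsd-cm`, line owner `bsd-cm-k7r-c4` g13, planner pointer D384 «K-CUT-1»; helper `--supports` 19945;
# theorems only; nothing asserted, no item closed)

WHY THIS FILE. The skeleton of record `Cruxes/EllipticUnitValueSevenOfGZK/Lines/kato_perrin_riou_zp.lean`
(55736b0247cfebd7) concludes the crux from SIX closed stubs through seat k7r-c4 g9's record
`ValueOfKMCPerrinRiou.valueSevenOfGZK_of_kmc_of_perrinRiou`, whose hypothesis `hread : ReadsTrivialKMC IsOf KMC`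
is the IFF reading — stub 5 `stub_readsTrivialKMCFine`. Only its `→` half is used on the composition path
(`TorsionFree.rankOne_missingPPartAt_of_kmc_of_perrinRiou`), and that half is KERNEL at the closed binders
(glue p612876). §1 re-proves g9's §1–§3 over the weaker binder
`(hread : ∀ W p D, IsOf W p D → KMC W p → D.Conj1210)` (generic part:
`…Theorems.KatoDescentKMCImpReading`); §2 instantiates at the closed triple and discharges the binder by
`KatoDescentKMCImpReading.conj1210_of_isOf_of_kmcFine`, so that

  `valueSevenOfGZK_of_kmcFine_of_perrinRiouRatio :`
  `  RankOneCountReading♭ → RealizableOfKMC♭ → modularity → Cassels → (∀ 𝒞₇, KMC_fine) → (∀ 𝒞₇, PR^×) → crux`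

is the composition of a FIVE-stub skeleton (stubs 1, 2, 3, 4, 6 of the registered line, verbatim signatures;
stub 5 deleted) — for the planner to re-point and re-register (this file registers nothing).

HONEST LABEL: every statement is CONDITIONAL on displayed hypotheses; the two research inputs (Perrin-Riou's
conjecture up to a `7`-adic unit at the additive prime `7`, Kato's Main Conjecture 12.10 in fine-Selmer form)
and the two print readings remain hypotheses; nothing about them or about BSD is asserted; no definition, no
named fact, no instance, no `sorry`; the crux is concluded BY NAME, never restated; 19945 stays OPEN; BSD is
not proved for any curve by any of this.
[cite: BurnsKuriharaSano2019, Thm. 7.6 (p. 29), Conj. 2.8 (ii) (p. 10)] [cite: Kato2004Asterisque, Conj. 12.10 (p. 224), §14.14 (p. 243)]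
[cite: PerrinRiou1993AIF, §3.3] [cite: Cassels1965ArithmeticVIII] [cite: Miller2011LMS, §1 and Def. 1.1]
-/

noncomputable section

open scoped Classical NumberField

open WeierstrassCurve Literature.NumberTheory.EllipticCurves
open Literature.NumberTheory.EllipticCurves.Rank1Residual
open Literature.NumberTheory.EllipticCurves.Rank1Residual.Typed
open Summit.BirchSwinnertonDyer.Rank1Residual
open Summit.BirchSwinnertonDyer.Rank1Residual.Additive
open Summit.BirchSwinnertonDyer.Rank1Residual.X12.O11
open Summit.BirchSwinnertonDyer.BirchSwinnertonDyer.Theses.RamifiedSevenEllipticUnits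
open Summit.BirchSwinnertonDyer.BirchSwinnertonDyer.Theorems.KatoDescentKMCImpReading

namespace Summit.BirchSwinnertonDyer.BirchSwinnertonDyer.Theorems.RamifiedSevenEllipticUnits

namespace ValueOfKMCImpReading

/-! ## §1 Over the interface binders, with the `→`-only reading -/

section Descent

variable {IsOf : ∀ (W : WeierstrassCurve ℚ) [W.IsElliptic] [W.IsGloballyMinimal] (p : ℕ) [Fact p.Prime],
  KatoDescentDatum p → Prop}
variable {PRRatio : ∀ (W : WeierstrassCurve ℚ) [W.IsElliptic] [W.IsGloballyMinimal] (p : ℕ)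
  [Fact p.Prime], ℚ_[p] → Prop}
variable {KMC : ∀ (W : WeierstrassCurve ℚ) [W.IsElliptic] [W.IsGloballyMinimal] (p : ℕ), Prop}

/-- **`BSD(W, 7)` at a member of 𝒞₇ from KMC(T₇W) ∧ PR^×(W, 7), over the `→`-only reading** — the generic
descent `KatoDescentKMCImpReading.rankOne_missingPPartAt_of_kmcImp_of_perrinRiou` (BKS Thm. 7.6 at `r = 1`
in Kato's `𝐇²`-formalism, image-free), side conditions by g9's §0 (`addv_seven`, `padicValRat_j_nonneg`,
`not_seven_dvd_torsionOrder`), then `bsdp_of_missingPPartAt` (GZK). CONDITIONAL; nothing booked.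
[cite: BurnsKuriharaSano2019, Thm. 7.6 (p. 29)] [cite: Kato2004Asterisque, Conj. 12.10 (p. 224)] -/
theorem bsdp_seven_of_kmcImp_of_perrinRiou (hC : TorsionFree.RankOneCountReading IsOf PRRatio)
    (hreal : TorsionFree.RealizableOfKMC IsOf KMC)
    (hread : ∀ (W : WeierstrassCurve ℚ) [W.IsElliptic] [W.IsGloballyMinimal] (p : ℕ) [Fact p.Prime]
      (D : KatoDescentDatum p), IsOf W p D → KMC W p → D.Conj1210)
    (hGZK : rank_eq_analyticRank_of_analyticRank_le_one) (hmod : hasEntireLFunction_rat)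
    (W : WeierstrassCurve ℚ) [W.IsElliptic] [W.IsGloballyMinimal] [Fact (Nat.Prime 7)]
    (h7 : X12.ClassCSeven W) (hKMC : KMC W 7) (hPR : PerrinRiouUpToUnitAt PRRatio W 7) : BSDp W 7 :=
  bsdp_of_missingPPartAt W 7 hGZK (le_of_eq h7.2.2.1)
    (rankOne_missingPPartAt_of_kmcImp_of_perrinRiou W 7 hC hreal hread hGZK hmod h7.2.2.1
      (by norm_num) (ValueOfKMCPerrinRiou.addv_seven W h7) (ValueOfKMCPerrinRiou.padicValRat_j_nonneg W h7)
      (ValueOfKMCPerrinRiou.not_seven_dvd_torsionOrder W h7) hPR hKMC)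

/-- **The crux body `X12.O11.RamifiedCMBottomClassIndexLawAtZp W 7` at a member of 𝒞₇ from KMC(T₇W) ∧
PR^×(W, 7), over the `→`-only reading** — §1's `BSD(W, 7)` followed by k7r-c3 g7's seam
`RubinFormulaZpBsdp.ramifiedCMBottomClassIndexLawAtZp_of_bsdp` (Cassels, modularity, GZK). CONDITIONAL.
[cite: BurnsKuriharaSano2019, Thm. 7.6 (p. 29)] [cite: Miller2011LMS, Def. 1.1 (arXiv:1010.2431 p. 3)] [cite: Cassels1965ArithmeticVIII] -/
theorem indexLawAtZp_seven_of_kmcImp_of_perrinRiou (hC : TorsionFree.RankOneCountReading IsOf PRRatio)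
    (hreal : TorsionFree.RealizableOfKMC IsOf KMC)
    (hread : ∀ (W : WeierstrassCurve ℚ) [W.IsElliptic] [W.IsGloballyMinimal] (p : ℕ) [Fact p.Prime]
      (D : KatoDescentDatum p), IsOf W p D → KMC W p → D.Conj1210)
    (hGZK : rank_eq_analyticRank_of_analyticRank_le_one) (hmod : hasEntireLFunction_rat)
    (hCassels : bsdRHS_eq_of_isIsogenous)
    (W : WeierstrassCurve ℚ) [W.IsElliptic] [W.IsGloballyMinimal] [Fact (Nat.Prime 7)]
    (h7 : X12.ClassCSeven W) (hKMC : KMC W 7) (hPR : PerrinRiouUpToUnitAt PRRatio W 7) :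
    RamifiedCMBottomClassIndexLawAtZp W 7 :=
  RubinFormulaZpBsdp.ramifiedCMBottomClassIndexLawAtZp_of_bsdp hCassels hmod hGZK (le_of_eq h7.2.2.1)
    (bsdp_seven_of_kmcImp_of_perrinRiou hC hreal hread hGZK hmod W h7 hKMC hPR)

/-- **The body `X12.O11.RamifiedCMRubinFormulaAtZp W 7` of the former fit witness at a member of 𝒞₇ from
KMC(T₇W) ∧ PR^×(W, 7), over the `→`-only reading** (`RubinFormulaZpBsdp.ramifiedCMRubinFormulaAtZp_of_bsdp`).
CONDITIONAL. [cite: BurnsKuriharaSano2019, Thm. 7.6 (p. 29)] [cite: Cassels1965ArithmeticVIII] -/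
theorem rubinFormulaAtZp_seven_of_kmcImp_of_perrinRiou (hC : TorsionFree.RankOneCountReading IsOf PRRatio)
    (hreal : TorsionFree.RealizableOfKMC IsOf KMC)
    (hread : ∀ (W : WeierstrassCurve ℚ) [W.IsElliptic] [W.IsGloballyMinimal] (p : ℕ) [Fact p.Prime]
      (D : KatoDescentDatum p), IsOf W p D → KMC W p → D.Conj1210)
    (hGZK : rank_eq_analyticRank_of_analyticRank_le_one) (hmod : hasEntireLFunction_rat)
    (hCassels : bsdRHS_eq_of_isIsogenous)
    (W : WeierstrassCurve ℚ) [W.IsElliptic] [W.IsGloballyMinimal] [Fact (Nat.Prime 7)]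
    (h7 : X12.ClassCSeven W) (hKMC : KMC W 7) (hPR : PerrinRiouUpToUnitAt PRRatio W 7) :
    RamifiedCMRubinFormulaAtZp W 7 :=
  RubinFormulaZpBsdp.ramifiedCMRubinFormulaAtZp_of_bsdp hCassels hmod hGZK (le_of_eq h7.2.2.1)
    (bsdp_seven_of_kmcImp_of_perrinRiou hC hreal hread hGZK hmod W h7 hKMC hPR)

/-- **Crux 19945 `EllipticUnitValueSevenOfGZK` ⟸ KMC(T₇W) ∧ PR^×(W, 7) at every `W ∈ 𝒞₇`, over the
`→`-ONLY reading** (and readings 1″♭ / 3♭, Cassels, modularity; GZK is the crux's own antecedent). g9's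
`ValueOfKMCPerrinRiou.valueSevenOfGZK_of_kmc_of_perrinRiou` with `ReadsTrivialKMC IsOf KMC` weakened to the
binder; the old record is the special case `hread := kmcImp_of_readsTrivialKMC h`. The crux is concluded BY
NAME. CONDITIONAL; nothing booked; 19945 stays OPEN.
[cite: BurnsKuriharaSano2019, Thm. 7.6 (p. 29)] [cite: Kato2004Asterisque, Conj. 12.10 (p. 224), §15]
[cite: PerrinRiou1993AIF, §3.3] [cite: Cassels1965ArithmeticVIII] -/
theorem valueSevenOfGZK_of_kmcImp_of_perrinRiou (hC : TorsionFree.RankOneCountReading IsOf PRRatio)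
    (hreal : TorsionFree.RealizableOfKMC IsOf KMC)
    (hread : ∀ (W : WeierstrassCurve ℚ) [W.IsElliptic] [W.IsGloballyMinimal] (p : ℕ) [Fact p.Prime]
      (D : KatoDescentDatum p), IsOf W p D → KMC W p → D.Conj1210)
    (hmod : hasEntireLFunction_rat) (hCassels : bsdRHS_eq_of_isIsogenous)
    (hKMC : ∀ (W : WeierstrassCurve ℚ) [W.IsElliptic] [W.IsGloballyMinimal] [Fact (Nat.Prime 7)],
      X12.ClassCSeven W → KMC W 7)
    (hPR : ∀ (W : WeierstrassCurve ℚ) [W.IsElliptic] [W.IsGloballyMinimal] [Fact (Nat.Prime 7)],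
      X12.ClassCSeven W → PerrinRiouUpToUnitAt PRRatio W 7) :
    EllipticUnitValueSevenOfGZK :=
  fun hGZK W _ _ _ h7 ↦ indexLawAtZp_seven_of_kmcImp_of_perrinRiou hC hreal hread hGZK hmod hCassels W h7
    (hKMC W h7) (hPR W h7)

/-- **`∀ W ∈ 𝒞₇, X12.O11.RamifiedCMRubinFormulaAtZp W 7` (the signature of the former fit witness
`stub_rubinFormulaSevenZp` of the line `rubin-formula-zp`) from KMC ∧ PR^× on 𝒞₇, over the `→`-only
reading.** CONDITIONAL. [cite: BurnsKuriharaSano2019, Thm. 7.6 (p. 29)] [cite: Cassels1965ArithmeticVIII] -/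
theorem rubinFormulaSevenZp_of_kmcImp_of_perrinRiou (hC : TorsionFree.RankOneCountReading IsOf PRRatio)
    (hreal : TorsionFree.RealizableOfKMC IsOf KMC)
    (hread : ∀ (W : WeierstrassCurve ℚ) [W.IsElliptic] [W.IsGloballyMinimal] (p : ℕ) [Fact p.Prime]
      (D : KatoDescentDatum p), IsOf W p D → KMC W p → D.Conj1210)
    (hGZK : rank_eq_analyticRank_of_analyticRank_le_one) (hmod : hasEntireLFunction_rat)
    (hCassels : bsdRHS_eq_of_isIsogenous)
    (hKMC : ∀ (W : WeierstrassCurve ℚ) [W.IsElliptic] [W.IsGloballyMinimal] [Fact (Nat.Prime 7)],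
      X12.ClassCSeven W → KMC W 7)
    (hPR : ∀ (W : WeierstrassCurve ℚ) [W.IsElliptic] [W.IsGloballyMinimal] [Fact (Nat.Prime 7)],
      X12.ClassCSeven W → PerrinRiouUpToUnitAt PRRatio W 7) :
    ∀ (W : WeierstrassCurve ℚ) [W.IsElliptic] [W.IsGloballyMinimal] [Fact (Nat.Prime 7)],
      X12.ClassCSeven W → X12.O11.RamifiedCMRubinFormulaAtZp W 7 :=
  fun W _ _ _ h7 ↦ rubinFormulaAtZp_seven_of_kmcImp_of_perrinRiou hC hreal hread hGZK hmod hCassels W h7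
    (hKMC W h7) (hPR W h7)

end Descent

/-! ## §2 At the CLOSED triple: the crux BY NAME from FIVE stub-shaped hypotheses -/

section Closed

/-- **Crux 19945 `EllipticUnitValueSevenOfGZK` BY NAME from the FIVE remaining stubs of the Kato–Perrin-Riou
line** — reading 1″♭ `TorsionFree.RankOneCountReading IsKatoZetaDescentDatumOf Kato2004.PRRatio` (stub 3),
reading 3♭ `TorsionFree.RealizableOfKMC IsKatoZetaDescentDatumOf KatoMainConjectureFine` (stub 4), modularity
and Cassels (stub 6, as two hypotheses), `∀ W ∈ 𝒞₇, KatoMainConjectureFine W 7` (stub 2) and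
`∀ W ∈ 𝒞₇, PerrinRiouUpToUnitAt Kato2004.PRRatio W 7` (stub 1) — the interface lemma (former stub 5) being
DISCHARGED by `KatoDescentKMCImpReading.conj1210_of_isOf_of_kmcFine` (glue p612876). Intended as the composition
term of the re-pointed skeleton (planner's registration; this file registers nothing). CONDITIONAL on the five
displayed hypotheses — two research inputs at the additive prime `7`, two print readings, one print bundle;
nothing booked; 19945 stays OPEN; BSD is not proved for any curve.
[cite: BurnsKuriharaSano2019, Thm. 7.6 (p. 29), Conj. 2.8 (ii) (p. 10)] [cite: Kato2004Asterisque, Conj. 12.10 (p. 224), §14.14 (p. 243)]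
[cite: PerrinRiou1993AIF, §3.3] [cite: Cassels1965ArithmeticVIII] -/
theorem valueSevenOfGZK_of_kmcFine_of_perrinRiouRatio
    (hC : TorsionFree.RankOneCountReading IsKatoZetaDescentDatumOf Kato2004.PRRatio)
    (hreal : TorsionFree.RealizableOfKMC IsKatoZetaDescentDatumOf KatoMainConjectureFine)
    (hmod : hasEntireLFunction_rat) (hCassels : bsdRHS_eq_of_isIsogenous)
    (hKMC : ∀ (W : WeierstrassCurve ℚ) [W.IsElliptic] [W.IsGloballyMinimal] [Fact (Nat.Prime 7)],
      X12.ClassCSeven W → KatoMainConjectureFine W 7)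
    (hPR : ∀ (W : WeierstrassCurve ℚ) [W.IsElliptic] [W.IsGloballyMinimal] [Fact (Nat.Prime 7)],
      X12.ClassCSeven W → PerrinRiouUpToUnitAt Kato2004.PRRatio W 7) :
    EllipticUnitValueSevenOfGZK :=
  valueSevenOfGZK_of_kmcImp_of_perrinRiou hC hreal conj1210_of_isOf_of_kmcFine hmod hCassels hKMC hPR

/-- **`∀ W ∈ 𝒞₇, X12.O11.RamifiedCMRubinFormulaAtZp W 7` from the same five hypotheses plus GZK** (the former
fit witness's signature at the closed triple). CONDITIONAL. [cite: BurnsKuriharaSano2019, Thm. 7.6 (p. 29)]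
[cite: Cassels1965ArithmeticVIII] -/
theorem rubinFormulaSevenZp_of_kmcFine_of_perrinRiouRatio
    (hC : TorsionFree.RankOneCountReading IsKatoZetaDescentDatumOf Kato2004.PRRatio)
    (hreal : TorsionFree.RealizableOfKMC IsKatoZetaDescentDatumOf KatoMainConjectureFine)
    (hGZK : rank_eq_analyticRank_of_analyticRank_le_one) (hmod : hasEntireLFunction_rat)
    (hCassels : bsdRHS_eq_of_isIsogenous)
    (hKMC : ∀ (W : WeierstrassCurve ℚ) [W.IsElliptic] [W.IsGloballyMinimal] [Fact (Nat.Prime 7)],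
      X12.ClassCSeven W → KatoMainConjectureFine W 7)
    (hPR : ∀ (W : WeierstrassCurve ℚ) [W.IsElliptic] [W.IsGloballyMinimal] [Fact (Nat.Prime 7)],
      X12.ClassCSeven W → PerrinRiouUpToUnitAt Kato2004.PRRatio W 7) :
    ∀ (W : WeierstrassCurve ℚ) [W.IsElliptic] [W.IsGloballyMinimal] [Fact (Nat.Prime 7)],
      X12.ClassCSeven W → X12.O11.RamifiedCMRubinFormulaAtZp W 7 :=
  rubinFormulaSevenZp_of_kmcImp_of_perrinRiou hC hreal conj1210_of_isOf_of_kmcFine hGZK hmod hCassels hKMC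
    hPR

/-- **`BSD(W, 7)` at a member of 𝒞₇ at the closed triple** — per-member form of §2 (no interface-lemma
hypothesis). CONDITIONAL. [cite: BurnsKuriharaSano2019, Thm. 7.6 (p. 29)] [cite: Kato2004Asterisque, Conj. 12.10 (p. 224)] -/
theorem bsdp_seven_of_kmcFine_of_perrinRiouRatio
    (hC : TorsionFree.RankOneCountReading IsKatoZetaDescentDatumOf Kato2004.PRRatio)
    (hreal : TorsionFree.RealizableOfKMC IsKatoZetaDescentDatumOf KatoMainConjectureFine)
    (hGZK : rank_eq_analyticRank_of_analyticRank_le_one) (hmod : hasEntireLFunction_rat)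
    (W : WeierstrassCurve ℚ) [W.IsElliptic] [W.IsGloballyMinimal] [Fact (Nat.Prime 7)]
    (h7 : X12.ClassCSeven W) (hKMC : KatoMainConjectureFine W 7)
    (hPR : PerrinRiouUpToUnitAt Kato2004.PRRatio W 7) : BSDp W 7 :=
  bsdp_seven_of_kmcImp_of_perrinRiou hC hreal conj1210_of_isOf_of_kmcFine hGZK hmod W h7 hKMC hPR

end Closed

end ValueOfKMCImpReading

end Summit.BirchSwinnertonDyer.BirchSwinnertonDyer.Theorems.RamifiedSevenEllipticUnits

end
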